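/-
  Summits/AtomisticToContinuum/Crystallization/Theorems/OverbindingBudgetAffineFarCharting.lean

  residual stmt-AtomisticToContinuum-31280 · slot Z `FarAggregatePricing 12 (1/25) (1/2000) (1/(2·10⁷))` · leaf Zr‴a′
  `ShelteredFarCharting' (1/25) (1/2000)` (leaf list v14′; critic rows 949/953): Zr‴a′ part 2 — THE FAR PATTERN OF THE BASE CHART and
  the deciding theorems `shelteredFarCharting'_of_engine : BarlowBallIdentificationSharp → ShelteredFarCharting' (1/25) (1/2000)`,
  `shelteredFarCharting'_of_ballBarlowFact : BallBarlowFact → ShelteredFarCharting' (1/25) (1/2000)` — Zr‴a′ ⟸ BBI₀ (port·S).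
  decomp-a2c lens-4, generation 59.  Imports Zr‴a′ part 1 `…FarBaseChart`.  0 sorry · 0 axiom · no instance · no notation · no option.
-/
import Summits.AtomisticToContinuum.Crystallization.Theorems.OverbindingBudgetAffineFarBaseChart

/-! # Zr‴a′ part 2 — `PatternFar` for the base chart; `ShelteredFarCharting' (1/25) (1/2000)` ⟸ BBI♯ (PROVED), hence ⟸ `BallBarlowFact`

For a sheltered normal far site `i` (`i ∈ shelteredFarSet R (1/2000) 12 ε₁ (1/25) δ y`): `i` is GOOD, so `AffFramed ε₁ (1/25) (1/450) y i`
— an affine frame `(Q₁, A₁, P₁, f₁)` of the fcc or hcp two-shell pattern fitted by sites within `ε₁·nn_i`; `i` is FAR and not scale-bad, so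
`¬ AffFramed ε₁ (1/2000) (1/450) y i` — whence NO linear isometry is `(1/2000)`-close to `A₁` on `P₁` (else `(Q, A₁, P₁, f₁)` would frame).
With the shelter radius `R := ρ_R := 50 + 2ρ₀` every site of the `ρ_R·nn_i`-ball is good, so E4 part 3 gives an ENGINE FRAME
(`τ = 2C_Rρ_R²ε₁`), BBI♯ bases it (E4 part 4 §1, `r = 25/2`), and part 1 gives the BASE CHART `c` (`IsChart (2C_Rρ_R²) ε₁ y i c`,
`ChartAdmissible (1/25) c`).  The far pattern of `c`: `A₀ := A₁`, `P := P₁`, `π v := g⁻¹(x k_v)` for the site `y k_v = f₁ v` — `k_v` is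
inner, `x k_v` is a nonzero two-shell vector by the EXHAUSTIVENESS of the frame's pattern at the centre (`‖B x k_v‖ ≤ 3/2`), `π v ∈ 𝓛(c.s)`
by inclusion, `π` is injective (frame injectivity + `InjOn f₁`), and the fit `‖(c.a₀/c.nn) • c.B(π v) − A₁ v‖ ≤ (5/2)τ + (51/50)ε₁`
transfers from `‖a₀ • B(x k_v) − nn_i • A₁ v‖ ≤ (τ + ε₁)·nn_i` and `|c.nn − nn_i| ≤ τ·nn_i`.

Constants of `ShelteredFarCharting' (1/25) (1/2000)` (given `R_aff′ = ⟨C_R, …⟩`, `BBI♯ = ⟨ρ₀, …⟩`, the pattern tolerance `τ_* > 0`):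
`R := λ := 50 + 2ρ₀`, `C := 2C_Rλ²`, `ε_A := min (1/(200K)) (τ_*/(8K))`, `K := (C_R + 1)λ²`.

* `chart_fit_transfer` — the fit transfer (a normed-space inequality).
* `EngineFrame.fit_inner`, `EngineFrame.frame_site` — a site fitting a frame point of the centre is `≠ i`, inner, with nonzero two-shell
  coordinate and fit numerator `≤ (τ + ε₁)·nn_i`.
* `EngineFrame.base_patternFar` — `PatternFar θ₀ t c` for the base chart of a far, `(1/25)`-framed centre, `t ≥ (5/2)τ + (51/50)ε₁`.
* `shelteredFarCharting'_of_engine`, `shelteredFarCharting'_of_ballBarlowFact` — the deciding theorems.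
-/

namespace Summit.AtomisticToContinuum.Crystallization.Theorems.OverbindingBudgetAffineFarSmoothSplit

open Literature.MathematicalPhysics.StatisticalMechanics
open Literature.Geometry.DiscreteGeometry
open Summit.AtomisticToContinuum.Crystallization.Theorems.OverbindingBudgetAffineLadder
open Summit.AtomisticToContinuum.Crystallization.Theorems.OverbindingBudgetAffineLocalisation
open scoped Classical

/-! ## §1  The fit transfer -/

/-- **FIT TRANSFER (PROVED).**  `‖w − nn • u‖ ≤ (τ + ε₁)·nn`, `|c − nn| ≤ τ·nn`, `‖u‖ ≤ √2 + 1/25`, `0 ≤ τ ≤ 1/100`, `0 ≤ ε₁`, `nn > 0`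
give `‖c⁻¹ • w − u‖ ≤ t` for every `t ≥ (5/2)τ + (51/50)ε₁`. [this file] -/
theorem chart_fit_transfer {w u : EuclideanSpace ℝ (Fin 3)} {nn cnn τ ε₁ t : ℝ} (hnn : 0 < nn) (hτ0 : 0 ≤ τ)
    (hτ : τ ≤ 1 / 100) (hε₁ : 0 ≤ ε₁) (hcnn : |cnn - nn| ≤ τ * nn) (hu : ‖u‖ ≤ Real.sqrt 2 + 1 / 25)
    (hw : ‖w - nn • u‖ ≤ (τ + ε₁) * nn) (ht : 5 / 2 * τ + 51 / 50 * ε₁ ≤ t) : ‖cnn⁻¹ • w - u‖ ≤ t := by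
  have h2lt : Real.sqrt 2 < 283 / 200 := (Real.sqrt_lt' (by norm_num)).2 (by norm_num)
  obtain ⟨hc1, hc2⟩ := abs_le.1 hcnn
  have hcnn_lo : (1 - τ) * nn ≤ cnn := by linarith
  have hcnn_pos : 0 < cnn := by
    have h := mul_le_mul_of_nonneg_right (show (99 / 100 : ℝ) ≤ 1 - τ by linarith) hnn.le
    linarith
  have e2 : cnn⁻¹ • w - u = cnn⁻¹ • (w - cnn • u) := by
    rw [smul_sub, smul_smul, inv_mul_cancel₀ hcnn_pos.ne', one_smul]
  rw [e2, norm_smul, Real.norm_eq_abs, abs_of_pos (inv_pos.2 hcnn_pos), inv_mul_le_iff₀ hcnn_pos]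
  have hL : ‖w - cnn • u‖ ≤ ‖w - nn • u‖ + ‖nn • u - cnn • u‖ := norm_sub_le_norm_sub_add_norm_sub _ _ _
  have hL2 : ‖nn • u - cnn • u‖ ≤ τ * nn * (Real.sqrt 2 + 1 / 25) := by
    rw [← sub_smul, norm_smul, Real.norm_eq_abs, abs_sub_comm]
    exact mul_le_mul hcnn hu (norm_nonneg _) (mul_nonneg hτ0 hnn.le)
  have p1 : τ * τ ≤ 1 / 100 * τ := mul_le_mul_of_nonneg_right hτ hτ0
  have p2 : ε₁ * τ ≤ ε₁ * (1 / 100) := mul_le_mul_of_nonneg_left hτ hε₁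
  have p3 : Real.sqrt 2 * τ ≤ 283 / 200 * τ := mul_le_mul_of_nonneg_right h2lt.le hτ0
  have hM : (τ + ε₁) + τ * (Real.sqrt 2 + 1 / 25) ≤ (1 - τ) * (5 / 2 * τ + 51 / 50 * ε₁) := by linarith
  have hq : 0 ≤ 5 / 2 * τ + 51 / 50 * ε₁ := by positivity
  have h1 := mul_le_mul_of_nonneg_right hM hnn.le
  have h2a := mul_le_mul_of_nonneg_right hcnn_lo hq
  have h2b := mul_le_mul_of_nonneg_left ht hcnn_pos.le
  linarith

namespace EngineFrame

variable {N : ℕ} {y : Fin N → EuclideanSpace ℝ (Fin 3)} {i : Fin N} {ρR a₀ τ : ℝ}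
  {B : EuclideanSpace ℝ (Fin 3) →ₗ[ℝ] EuclideanSpace ℝ (Fin 3)} {x : Fin N → EuclideanSpace ℝ (Fin 3)}

/-! ## §2  Sites fitting the centre's affine frame -/

/-- **FRAME-POINT SITES, metric part (PROVED)**: if `y k` fits `y i + nn_i • u` within `ε₁·nn_i` (`ε₁ ≤ 1/100`, `24/25 ≤ ‖u‖ ≤ √2 + 1/25`),
then `k ≠ i`, `dist(y k, y i) ≤ (√2 + 1/25 + ε₁)·nn_i`, and `‖a₀ • B(x k) − nn_i • u‖ ≤ (τ + ε₁)·nn_i`. [this file] -/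
theorem fit_inner (hF : EngineFrame y i ρR a₀ τ B x) {ε₁ : ℝ} (hε₁' : ε₁ ≤ 1 / 100) {k : Fin N} {u : EuclideanSpace ℝ (Fin 3)}
    (hulo : 24 / 25 ≤ ‖u‖) (huhi : ‖u‖ ≤ Real.sqrt 2 + 1 / 25)
    (hd : dist (y k) (y i + nearestDist y i • u) ≤ ε₁ * nearestDist y i) :
    k ≠ i ∧ dist (y k) (y i) ≤ (Real.sqrt 2 + 1 / 25 + ε₁) * nearestDist y i ∧
      ‖a₀ • B (x k) - nearestDist y i • u‖ ≤ (τ + ε₁) * nearestDist y i := by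
  have hnn := hF.nn_pos
  have hnu : ‖nearestDist y i • u‖ = nearestDist y i * ‖u‖ := by rw [norm_smul, Real.norm_eq_abs, abs_of_pos hnn]
  refine ⟨fun h => ?_, ?_, ?_⟩
  · rw [h, dist_comm, dist_eq_norm, add_sub_cancel_left, hnu] at hd
    have h1 := mul_le_mul_of_nonneg_left hulo hnn.le
    have h2 := mul_le_mul_of_nonneg_right hε₁' hnn.le
    linarith
  · have h1 : dist (y k) (y i) ≤ dist (y k) (y i + nearestDist y i • u) + dist (y i + nearestDist y i • u) (y i) :=
      dist_triangle _ _ _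
    rw [dist_eq_norm (y i + _), add_sub_cancel_left, hnu] at h1
    have h2 := mul_le_mul_of_nonneg_left huhi hnn.le
    linarith
  · have e : a₀ • B (x k) - nearestDist y i • u = (y k - (y i + nearestDist y i • u)) - (y k - y i - a₀ • B (x k)) := by abel
    rw [e, add_comm τ ε₁, add_mul]
    refine (norm_sub_le _ _).trans (add_le_add ?_ (hF.close k))
    rw [← dist_eq_norm]; exact hd

/-- **FRAME-POINT SITES (PROVED)**: under the hypotheses of `fit_inner`, `k ≠ i`, `k` is inner, and `x k` is a NONZERO vector of norm `≤ 3/2`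
(indeed `‖x k‖ ∈ {1, √2}`: `‖B(x k)‖ ≤ 3/2`, so the exhaustive two-shell pattern of the frame at the centre contains `x k`). [this file] -/
theorem frame_site (hF : EngineFrame y i ρR a₀ τ B x) {ε₁ : ℝ} (hε₁' : ε₁ ≤ 1 / 100) {k : Fin N} {u : EuclideanSpace ℝ (Fin 3)}
    (hulo : 24 / 25 ≤ ‖u‖) (huhi : ‖u‖ ≤ Real.sqrt 2 + 1 / 25)
    (hd : dist (y k) (y i + nearestDist y i • u) ≤ ε₁ * nearestDist y i) :
    k ≠ i ∧ dist (y k) (y i) ≤ (ρR - 3) * nearestDist y i ∧ x k ≠ 0 ∧ ‖x k‖ ≤ 3 / 2 ∧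
      ‖a₀ • B (x k) - nearestDist y i • u‖ ≤ (τ + ε₁) * nearestDist y i := by
  have hnn := hF.nn_pos
  have h2lt : Real.sqrt 2 < 283 / 200 := (Real.sqrt_lt' (by norm_num)).2 (by norm_num)
  obtain ⟨hki, hdist, hfit⟩ := hF.fit_inner hε₁' hulo huhi hd
  have hkJ : dist (y k) (y i) ≤ (ρR - 3) * nearestDist y i :=
    hdist.trans (mul_le_mul_of_nonneg_right (by linarith [hF.ρR_ge, h2lt]) hnn.le)
  -- `‖B (x k)‖ ≤ 3/2`
  have hBx : ‖B (x k - x i)‖ ≤ 3 / 2 := by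
    rw [hF.x_centre, sub_zero]
    have h3 : ‖a₀ • B (x k)‖ ≤ ‖y k - y i‖ + ‖y k - y i - a₀ • B (x k)‖ := by
      have := norm_sub_le (y k - y i) (y k - y i - a₀ • B (x k)); rwa [sub_sub_cancel] at this
    have hdist' : ‖y k - y i‖ ≤ (Real.sqrt 2 + 1 / 25 + ε₁) * nearestDist y i := by rwa [dist_eq_norm] at hdist
    rw [norm_smul, Real.norm_eq_abs, abs_of_pos hF.a₀_pos] at h3
    have h4 : τ * nearestDist y i ≤ 1 / 100 * nearestDist y i := mul_le_mul_of_nonneg_right hF.τ_le hnn.le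
    have h5 := mul_lt_mul_of_pos_right h2lt hnn
    have h6 := mul_le_mul_of_nonneg_right hε₁' hnn.le
    have h2 := hF.close k
    have h8 := hF.a₀_lo
    by_contra hlt
    have h7 : a₀ * (3 / 2) < a₀ * ‖B (x k)‖ := mul_lt_mul_of_pos_left (not_le.1 hlt) hF.a₀_pos
    linarith
  -- exhaustiveness of the frame's pattern at the centre
  obtain ⟨A', P', hP', -, hexh'⟩ := hF.pattern i hF.centre_inner
  obtain ⟨v', hv', hxv'⟩ := hexh' k hki hBx
  rw [hF.x_centre, zero_add] at hxv'
  have hxn : ‖x k‖ = 1 ∨ ‖x k‖ = Real.sqrt 2 := by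
    rw [hxv', A'.norm_map]
    rcases hP' with rfl | rfl
    exacts [norm_of_mem_fccTwoShellPattern hv', norm_of_mem_hcpTwoShellPattern hv']
  refine ⟨hki, hkJ, fun h0 => ?_, ?_, hfit⟩
  · rw [h0, norm_zero] at hxn
    rcases hxn with h | h
    · exact zero_ne_one h
    · have := Real.sqrt_pos.2 (show (0 : ℝ) < 2 by norm_num); linarith
  · rcases hxn with h | h
    · rw [h]; norm_num
    · rw [h]; linarith

/-! ## §3  The far pattern of the base chart -/

/-- **`PatternFar` FOR THE BASE CHART (PROVED).**  For a based frame (inclusion at `r ≥ 25/2`), a chart with `𝓛(c.s) = 𝓛(s) − p₀`,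
`c.a₀ • c.B = a₀ • B ∘ g`, `|c.nn − nn_i| ≤ τ·nn_i`, and a centre that is `(ε₁, 1/25)`-framed but NOT `(ε₁, θ₀)`-framed (`0 < ε₁ ≤ 1/100`):
`PatternFar θ₀ t c` for every `t ≥ (5/2)τ + (51/50)ε₁` — with the frame's own `A₁`, `P₁` and the labels `π v := g⁻¹(x k_v)`. [this file] -/
theorem base_patternFar (hF : EngineFrame y i ρR a₀ τ B x) {s : ℤ → ℤ}
    (g : EuclideanSpace ℝ (Fin 3) ≃ₗᵢ[ℝ] EuclideanSpace ℝ (Fin 3)) {p₀ : EuclideanSpace ℝ (Fin 3)} {r : ℝ} (hr : 25 / 2 ≤ r)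
    (hincl : ∀ k, dist (y k) (y i) ≤ (ρR - 3) * nearestDist y i → ‖x k‖ ≤ r →
      ∃ p ∈ barlowStacking 1 (Real.sqrt (2 / 3)) s, x k = g (p - p₀))
    {c : Chart}
    (hiff : ∀ p : EuclideanSpace ℝ (Fin 3),
      p ∈ barlowStacking 1 (Real.sqrt (2 / 3)) c.s ↔ p + p₀ ∈ barlowStacking 1 (Real.sqrt (2 / 3)) s)
    (hcB : ∀ v : EuclideanSpace ℝ (Fin 3), c.a₀ • c.B v = a₀ • B (g v))
    (hcnn : |c.nn - nearestDist y i| ≤ τ * nearestDist y i)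
    {ε₁ θ₀ t : ℝ} (hε₁ : 0 < ε₁) (hε₁' : ε₁ ≤ 1 / 100)
    (hfr : AffFramed ε₁ (1 / 25) (1 / 450) y i) (hfar : ¬ AffFramed ε₁ θ₀ (1 / 450) y i)
    (ht : 5 / 2 * τ + 51 / 50 * ε₁ ≤ t) : PatternFar θ₀ t c := by
  have hnn := hF.nn_pos
  obtain ⟨Q₁, A₁, P₁, f₁, hP₁, hAQ, hfit, hinj, hexh⟩ := hfr
  -- the frame images of the pattern vectors
  have hAv : ∀ v ∈ P₁, 24 / 25 ≤ ‖A₁ v‖ ∧ ‖A₁ v‖ ≤ Real.sqrt 2 + 1 / 25 := by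
    intro v hv
    have hn : ‖v‖ = 1 ∨ ‖v‖ = Real.sqrt 2 := by
      rcases hP₁ with rfl | rfl
      exacts [norm_of_mem_fccTwoShellPattern hv, norm_of_mem_hcpTwoShellPattern hv]
    have h12 : (1 : ℝ) ≤ Real.sqrt 2 := Real.one_le_sqrt.2 (by norm_num)
    have hv1 : 1 ≤ ‖v‖ ∧ ‖v‖ ≤ Real.sqrt 2 := by
      rcases hn with h | h
      · rw [h]; exact ⟨le_rfl, h12⟩
      · rw [h]; exact ⟨h12, le_rfl⟩
    have h3 := hAQ v hv
    have h4 := Q₁.norm_map v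
    have h5 := norm_le_insert' (Q₁ v) (A₁ v)
    have h6 := norm_le_insert' (A₁ v) (Q₁ v)
    rw [norm_sub_rev] at h5
    constructor <;> linarith [hv1.1, hv1.2]
  -- the sites of the frame points
  have hfit' : ∀ v ∈ P₁, ∃ k, y k = f₁ v := fun v hv => (hfit v hv).1
  haveI : Nonempty (Fin N) := ⟨i⟩
  choose! kf hkf using hfit'
  have key : ∀ v ∈ P₁, kf v ≠ i ∧ dist (y (kf v)) (y i) ≤ (ρR - 3) * nearestDist y i ∧ x (kf v) ≠ 0 ∧ ‖x (kf v)‖ ≤ 3 / 2 ∧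
      ‖a₀ • B (x (kf v)) - nearestDist y i • A₁ v‖ ≤ (τ + ε₁) * nearestDist y i := by
    intro v hv
    obtain ⟨hlo, hhi⟩ := hAv v hv
    have hd := (hfit v hv).2
    rw [← hkf v hv] at hd
    exact hF.frame_site hε₁' hlo hhi hd
  -- the labels are structure points of the base chart (inclusion)
  have hlab : ∀ v ∈ P₁, g.symm (x (kf v)) + p₀ ∈ barlowStacking 1 (Real.sqrt (2 / 3)) s := by
    intro v hv
    obtain ⟨-, hkJ, -, hx32, -⟩ := key v hv
    obtain ⟨p, hp, hxp⟩ := hincl (kf v) hkJ (by linarith)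
    rw [hxp, LinearIsometryEquiv.symm_apply_apply, sub_add_cancel]; exact hp
  refine ⟨A₁, P₁, fun v => g.symm (x (kf v)), hP₁, fun v hv => ⟨?_, ?_⟩, ?_, ?_⟩
  · -- in the reference two shells
    obtain ⟨-, -, hx0, hx32, -⟩ := key v hv
    simp only [twoShellRef, Set.mem_setOf_eq]
    refine ⟨(hiff _).2 (hlab v hv), fun h => hx0 ?_, by rw [LinearIsometryEquiv.norm_map]; exact hx32⟩
    rw [← g.apply_symm_apply (x (kf v)), h, map_zero]
  · -- the fit in the chart's normalisation
    obtain ⟨-, -, -, -, hfitv⟩ := key v hv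
    have e1 : (c.a₀ / c.nn) • c.B (g.symm (x (kf v))) = c.nn⁻¹ • (a₀ • B (x (kf v))) := by
      rw [div_eq_inv_mul, mul_smul, hcB, LinearIsometryEquiv.apply_symm_apply]
    rw [e1]
    exact chart_fit_transfer hnn hF.τ_nonneg hF.τ_le hε₁.le hcnn (hAv v hv).2 hfitv ht
  · -- injective labels
    intro v hv v' hv' hπ
    have hx : x (kf v') = x (kf v) := (g.symm.injective hπ).symm
    have hk : kf v' = kf v := hF.inj (key v (Finset.mem_coe.1 hv)).2.1 hx
    exact hinj hv hv' (by rw [← hkf v (Finset.mem_coe.1 hv), ← hkf v' (Finset.mem_coe.1 hv'), hk])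
  · -- far from every linear isometry: else the frame would `θ₀`-frame `i`
    intro Q
    by_contra hQ
    exact hfar ⟨Q, A₁, P₁, f₁, hP₁, fun v hv => not_lt.1 fun hlt => hQ ⟨v, hv, hlt⟩, hfit, hinj, hexh⟩

end EngineFrame

/-! ## §4  The deciding theorems -/

open EngineFrame in
/-- **ENGINE ⇒ Zr‴a′ (PROVED).** `BarlowBallIdentificationSharp → ShelteredFarCharting' (1/25) (1/2000)` (R_aff′ is Zr‴a′'s own antecedent;
`R = λ := 50 + 2ρ₀`, `C := 2C_Rλ²`, `ε_A := min (1/(200K)) (τ_*/(8K))`, `K := (C_R+1)λ²`). [this file] -/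
theorem shelteredFarCharting'_of_engine (hBBI : BarlowBallIdentificationSharp) : ShelteredFarCharting' (1 / 25) (1 / 2000) := by
  intro hR' t ht
  obtain ⟨C_R, hC_R, hRaff⟩ := hR'
  obtain ⟨ρ₀, hρ₀, hBBI⟩ := hBBI
  set lam : ℝ := 50 + 2 * ρ₀ with hlam
  set K : ℝ := (C_R + 1) * lam ^ 2 with hK
  have hlam50 : 50 ≤ lam := by rw [hlam]; linarith
  have hK1 : 1 ≤ K := by rw [hK]; nlinarith
  have hK0 : 0 < K := by linarith
  refine ⟨lam, 2 * C_R * lam ^ 2, min (1 / (200 * K)) (t / (8 * K)), by linarith, by positivity,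
    lt_min (by positivity) (by positivity), ?_⟩
  intro ε₁ hε₁ hε₁A δ hδ _ N y hy i hi
  have hKε : K * ε₁ ≤ 1 / 200 := by
    have h := hε₁A.trans (min_le_left _ _)
    rw [le_div_iff₀ (by positivity)] at h
    linarith
  have h8K : 8 * K * ε₁ ≤ t := by
    have h := hε₁A.trans (min_le_right _ _)
    rw [le_div_iff₀ (by positivity)] at h
    linarith
  have hε₁K : ε₁ ≤ K * ε₁ := le_mul_of_one_le_left hε₁.le hK1
  have hε₁' : ε₁ ≤ 1 / 100 := by linarith
  have hCK : C_R * lam ^ 2 ≤ K := by rw [hK]; nlinarith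
  have hCKε : C_R * lam ^ 2 * ε₁ ≤ K * ε₁ := mul_le_mul_of_nonneg_right hCK hε₁.le
  have hτ : C_R * lam ^ 2 * ε₁ ≤ 1 / 200 := by linarith
  -- the site: good (hence `(1/25)`-framed), far and not scale-bad (hence not `(1/2000)`-framed), sheltered at radius `λ`
  rw [mem_shelteredFarSet] at hi
  obtain ⟨⟨hifar, hnsb⟩, hSh⟩ := hi
  have hiG : i ∈ goodSet 12 ε₁ (1 / 25) δ y := farSet_subset_goodSet _ _ _ _ _ _ hifar
  have hfr : AffFramed ε₁ (1 / 25) (1 / 450) y i := by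
    have h := hiG
    unfold goodSet at h
    rw [Finset.mem_filter] at h
    exact (h.2.1 i (by rw [dist_self]; exact mul_nonneg (by norm_num) (nearestDist_nonneg y i))).2
  have hfar : ¬ AffFramed ε₁ (1 / 2000) (1 / 450) y i := by
    intro hA
    unfold farSet at hifar
    rw [Finset.mem_filter] at hifar
    apply hnsb
    unfold goodScaleBadSet
    rw [Finset.mem_filter]
    refine ⟨hiG, ?_⟩
    by_contra hsb
    exact hifar.2 ⟨hA, hsb⟩
  -- frame, base, base chart
  obtain ⟨a₀, B, x, hF⟩ := exists_engineFrame hC_R hRaff hε₁ hlam50 hτ hy hδ hSh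
  obtain ⟨s, g, p₀, hs, hp₀, hincl, hfill⟩ := hF.based hρ₀ (le_of_eq hlam.symm) hBBI
  have hr : 25 / 2 ≤ (lam / 2 - ρ₀) / 2 := by rw [hlam]; linarith
  obtain ⟨c, hadm, hiff, hcB, hcnn⟩ := hF.base_chart hs g hp₀ hr hincl hfill
  refine ⟨c, hF.base_isChart g hr hincl hfill hiff hcB hcnn hadm.2.1 le_rfl, hadm,
    hF.base_patternFar g hr hincl hiff hcB hcnn hε₁ hε₁' hfr hfar ?_⟩
  linarith

/-- **Zr‴a′ ⟸ BBI₀ (PROVED modulo the port `BallBarlowFact`).**  With BBI♯ ⟸ `BallBarlowFact` (E4 part 1,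
`barlowBallIdentificationSharp_of_ballBarlowFact`): `BallBarlowFact → ShelteredFarCharting' (1/25) (1/2000)`. [this file] -/
theorem shelteredFarCharting'_of_ballBarlowFact (h : BallBarlowFact) : ShelteredFarCharting' (1 / 25) (1 / 2000) :=
  shelteredFarCharting'_of_engine (barlowBallIdentificationSharp_of_ballBarlowFact h)

end Summit.AtomisticToContinuum.Crystallization.Theorems.OverbindingBudgetAffineFarSmoothSplit
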